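import Summits.FinalStateConjecture.FinalStateConjecture.Theorems.ClusterCompletenessOmegaLimitMultiKerrJointOmegaLimits
import HarnessLib

/-!
# Route ClusterCompleteness · crux `OmegaLimitMultiKerr` — the LaSalle reading of the JOINT
# recur-disjunct: along a joint recurrence sequence all holes have flat ω-limits, jointly

Structure lemma for the crux stmt-FinalStateConjecture-14664 (`ClusterCompleteness.OmegaLimitMultiKerr`,
rank 9), line `Sketch`, lead gen 3. Composition of the landed pieces
`exists_strictMono_forall_omegaLimit_translate` (joint ω-limits along one subsequence,
`…JointOmegaLimits`) and `iteratedFDeriv_omegaLimit_eq_zero_of_tendsto_supCkENorm_truncTimeSlab`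
(recurrence at every radius forces flat ω-limits, `…BackgroundOmegaLimits`):

**Theorem (`exists_strictMono_forall_omegaLimit_flat`).** For finitely many tame systems
`(Bᵢ, eᵢ, hᵢ)` and ONE sequence `T n → ∞` along which EVERY system recurs at every radius
(`supCkENorm {t = 0, r ≤ R'} k (hᵢ ∘ shift_{T n}) → 0` for all `i`, `R'` — the sequential form of the
crux's joint recurrence clause, `recurs_iff_exists_seq` + `truncDeviationCk_eq_supCkENorm_translate`),
ONE subsequence `φ` yields, for every `i`, a `Cᵏ_loc` ω-limit `gᵢ` of the translates which is FLAT TO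
ORDER `k` on the time-zero slab of `Bᵢ`. This is the honest output of the invariance principle on
the crux's text: the reference multi-Kerr configuration is a JOINT ω-limit point of the charted
geometry (Hale 1980, Ch. I, §8; idea card `lasalle-lands-on-liminf`).
-/

-- every `Summit.FinalStateConjecture.FinalStateConjecture.…` name repeats the summit = sub-problem segment (D-0017 layout)
set_option linter.dupNamespace false

noncomputable section

open Set Filter Topology Function TopologicalSpace
open scoped ContDiff Topology ENNReal

namespace Summit.FinalStateConjecture.FinalStateConjecture.Theorems.ClusterCompleteness

open Literature.Geometry.Lorentzian

/-- **Joint flat ω-limits along a joint recurrence sequence.** In the setting of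
`exists_strictMono_forall_omegaLimit_translate` (finitely many backgrounds `Bᵢ` with translation
vectors `eᵢ`, fields `hᵢ` of class `C^{k+1}` bounded on the truncated late regions), if along ONE
sequence `T n → ∞` every system recurs at every radius — the `Cᵏ` sup norms of the translates over
every time-zero truncated slab tend to `0` — then along ONE common subsequence every system has a
`Cᵏ_loc` ω-limit `gᵢ` all of whose derivatives of order `≤ k` vanish on the time-zero slab
`{t = 0}` of `Bᵢ` (Hale 1980, Ch. I, §8). [cite: Hale1980, Ch. I §8] -/
theorem exists_strictMono_forall_omegaLimit_flat :
    ∀ {W : Type*} [NormedAddCommGroup W] [NormedSpace ℝ W] [FiniteDimensional ℝ W]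
      (N : ℕ) (B : Fin N → ModelBackground) (e : Fin N → E4),
      (∀ i, ∀ x ∈ ((B i).domain : Set E4), ∀ s : ℝ, x + s • e i ∈ ((B i).domain : Set E4)) →
      (∀ i (x : E4) (s : ℝ), (B i).time (x + s • e i) = (B i).time x + s) →
      (∀ i (x : E4) (s : ℝ), (B i).radius (x + s • e i) = (B i).radius x) →
      (∀ i, Continuous (B i).time) → (∀ i, Continuous (B i).radius) →
      ∀ {k : ℕ} {h : Fin N → E4 → W}, (∀ i, ContDiffOn ℝ (k + 1) (h i) ((B i).domain : Set E4)) →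
      ∀ {τ₀ : ℝ}, (∀ i (R : ℝ), ∃ C : ℝ, ∀ j, j ≤ k + 1 →
        ∀ x ∈ Subtype.val '' (B i).truncLateRegion τ₀ R, ‖iteratedFDeriv ℝ j (h i) x‖ ≤ C) →
      ∀ {T : ℕ → ℝ}, Tendsto T atTop atTop →
      (∀ i (R' : ℝ), Tendsto (fun n ↦ supCkENorm (Subtype.val '' (B i).truncTimeSlab R' 0) k
        (fun x ↦ h i (x + T n • e i))) atTop (𝓝 0)) →
      ∃ φ : ℕ → ℕ, StrictMono φ ∧ ∀ i, ∃ g : E4 → W, ContDiffOn ℝ k g ((B i).domain : Set E4) ∧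
        (∀ K ⊆ ((B i).domain : Set E4), IsCompact K →
          Tendsto (fun n ↦ supCkENorm K k (fun x ↦ h i (x + T (φ n) • e i) - g x)) atTop (𝓝 0)) ∧
        ∀ x ∈ Subtype.val '' (B i).timeSlab 0, ∀ m, m ≤ k → iteratedFDeriv ℝ m g x = 0 := by
  intro W _ _ _ N B e hdom htime hrad htc hrc k h hh τ₀ hb T hT hrec
  obtain ⟨φ, hφ, hlim⟩ :=
    exists_strictMono_forall_omegaLimit_translate N B e hdom htime hrad htc hrc hh hb hT
  refine ⟨φ, hφ, fun i ↦ ?_⟩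
  obtain ⟨g, hg, hlimi⟩ := hlim i
  refine ⟨g, hg, hlimi, ?_⟩
  exact iteratedFDeriv_omegaLimit_eq_zero_of_tendsto_supCkENorm_truncTimeSlab (B i) (e i) (hdom i)
    (hh i) hg (T := T ∘ φ) hlimi (fun R' ↦ (hrec i R').comp hφ.tendsto_atTop)

end Summit.FinalStateConjecture.FinalStateConjecture.Theorems.ClusterCompleteness

end
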